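import Summits.HodgeConjecture.HodgeConjecture.Theorems.F0P3HJ3aOfLetters
import Literature.NumberTheory.Automorphic.UnitaryGroupCotangentSpectralProjectionConj
import Literature.NumberTheory.Automorphic.UnitaryGroupCohomologicalFormsConjRep
import HarnessLib

/-!
# Crux `H413` — `hJ3a` (row III-J3a) and `H413` FROM FIVE PRINTED-CITATION LETTERS {E1, E1′hol, E2′, (D)hol, (E)hol}

Floor-0 programme P3 «U3-mult», seat F0P3-p04 (g2); crux item stmt-HodgeConjecture-24833 (`HCCMUnconditional.H413`); line
`Cruxes/H413/Lines/F0_U3CohMultOne.lean`.  HC_CM is proved only modulo the printed citations until rung 0 closes.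

The eight-letter assembly ★ `HJ3aOfLetters.hJ3a_of_letters` (F0P3-p02 (g0), p793xxx) takes the three `(0,1)`-type letters
E1′antihol `cohFinComponentUnique_antihol`, (D)antihol `antiholCotFormSpectralProjection`, (E)antihol `cohIsotypicLine_antihol` as
hypotheses.  By complex conjugation on the automorphic side (the conjugate discrete representation `P̄ = DiscreteAutomorphicRep.conj`,
the conjugate finite representation `ConjVec.repConj σ`) each is a COROLLARY of its `(1,0)`-type twin — ★
`CotangentForms.cohFinComponentUnique_antihol_of_hol`, ★ `CotangentForms.antiholCotFormSpectralProjection_of_hol`, ★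
`CotangentForms.cohIsotypicLine_antihol_of_hol` (F0P2-p01 (g2), `UnitaryGroupCohomologicalFormsConjRep`,
`UnitaryGroupCotangentSpectralProjectionConj`).  Hence the P3 floor deliverable needs only FIVE printed-citation letters:
E1 `Rogawski1990.innerFormMultiplicityLeOne`, E1′hol `Rogawski1990.cohFinComponentUnique_hol`, E2′ `Rogawski1990.hodgeTypeRigid`,
(D)hol `CotangentForms.holCotFormSpectralProjection`, (E)hol `CotangentForms.cohIsotypicLine_hol`.  Conclusions VERBATIM as in
`F0P3HJ3aOfLetters` (= floor V7 ll. 76–80 for `hJ3a`; the crux decl by name for `H413`).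

References: [Liu2021] Prop. 4.13 and proof l. 2121–2146; [Rogawski1990] Thm. 14.6.4, §15.3 ¶1, Prop. 15.2.1 (b); [BorelWallach2000] VI 4.11.
-/

-- the mandated namespace repeats `HodgeConjecture.HodgeConjecture`, as in every `Theorems/*.lean` of this sub-problem
set_option linter.dupNamespace false

noncomputable section

namespace Summit.HodgeConjecture.HodgeConjecture.Cruxes.H413.HJ3aOfFiveLetters

open scoped TensorProduct Matrix
open NumberField NumberField.InfinitePlace IsDedekindDomain
open HodgeCM.Model HodgeCM.Model.LiuIndex HodgeCM.Model.TowerCarrier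
open Summit.HodgeConjecture.CorCM.Model
open Literature.AlgebraicGeometry.Motives (CMType AbelianVariety)
open Literature.AlgebraicGeometry.HodgeTheory Literature.NumberTheory.Automorphic.PicardCM
open Literature.AlgebraicGeometry.ShimuraVarieties Literature.AlgebraicGeometry.ShimuraVarieties.UnitaryCanonicalModel
open Literature.NumberTheory.ComplexMultiplication
open Literature.NumberTheory.Automorphic
open Literature.NumberTheory.Automorphic.Liu2021 Literature.NumberTheory.Automorphic.Liu2021.AppendixC
open Literature.NumberTheory.Automorphic.Liu2021.Def411WeilCarriers (lineOf locF Rep)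
open Summit.HodgeConjecture.CorCM.Transposition.OmegaTransport (realUnit)
open HodgeCM.Model.ArchSideTerm (e₁)
open Literature.NumberTheory.GelbartRogawski1991 Literature.NumberTheory.GelbartRogawski1991.UnitaryDualPair
open Literature.RepresentationTheory Literature.RepresentationTheory.Liu2021
open Summit.HodgeConjecture.CorCM
open Summit.HodgeConjecture.CorCM.Transposition
open Literature.NumberTheory.GelbartRogawski1991.OscillatorTripleDictionary (OccursInH1 IsIsoToOmega)
open Summit.HodgeConjecture.CorCM.Lines.A3Liu418 (Thm415AtFace EpsRigidAtFace)
open Summit.HodgeConjecture.HodgeConjecture.Theses (HCCMUnconditional.HDel)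
open MulAction
open Literature.Geometry.ComplexHyperbolic.BallModel (U21 x₀)
open Literature.NumberTheory.GelbartRogawski1991.OscillatorTripleDictionary (rhoTriple)
open Summit.HodgeConjecture.CorCM.Lines.A3Liu413 (datum413)
open Summit.HodgeConjecture.HodgeConjecture.Cruxes.H413.CohFormsCarriers
open Summit.HodgeConjecture.HodgeConjecture.Cruxes.H413.F0P3HJ3aAssembly (hJ3a_of_S345)
open Summit.HodgeConjecture.HodgeConjecture.Cruxes.H413.F0P3StubS3S4Holds (stubS3_holds stubS4_holds)
open Summit.HodgeConjecture.HodgeConjecture.Cruxes.H413.F0P3StubS5Fold (stubS5_holds)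
open Literature.NumberTheory.Automorphic.UnitaryGroup.CotangentForms (cohFinComponentUnique_antihol_of_hol
  antiholCotFormSpectralProjection_of_hol cohIsotypicLine_antihol_of_hol)

set_option synthInstance.maxHeartbeats 400000 in
set_option maxHeartbeats 8000000 in
/-- **`hJ3a` FROM FIVE LETTERS** (row III-J3a of the floor: `rank_ℂ Hom_{U(V)(𝔸_{F⁺,f})}(ω_V(t), H¹_{B,τ'}) ≤ 1` for every face, `3 ≤ n`,
`τ'`, `t`); conclusion = floor V7 ll. 76–80 VERBATIM.  Hypotheses: E1, E1′hol, E2′, (D)hol, (E)hol — the `(0,1)`-type twins are supplied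
by conjugation symmetry. HC_CM is proved only modulo the printed citations until rung 0 closes.
[cite: Liu2021, proof of Prop. 4.13, l. 2121–2146] [cite: Rogawski1990, Thm. 14.6.4; §15.3 ¶1] [cite: BorelWallach2000, VI 4.11] -/
theorem hJ3a_of_five_letters (hE1 : Literature.NumberTheory.Rogawski1990.innerFormMultiplicityLeOne)
    (hE1'h : Literature.NumberTheory.Rogawski1990.cohFinComponentUnique_hol)
    (hE2' : Literature.NumberTheory.Rogawski1990.hodgeTypeRigid)
    (hDh : Literature.NumberTheory.Automorphic.UnitaryGroup.CotangentForms.holCotFormSpectralProjection)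
    (hEh : Literature.NumberTheory.Automorphic.UnitaryGroup.CotangentForms.cohIsotypicLine_hol) :
    ∀ (hDel : Literature.AlgebraicGeometry.ShimuraVarieties.UnitaryCanonicalModel.canonicalModel_exists_printed)
    (F : HodgeCM.CMField) [IsGalois ℚ F] (h6 : 6 ≤ Module.finrank ℚ F) {ι₁ : F →+* ℂ} (V : HodgeCM.HermSpace3 F ι₁) (a₀ : RealScalar F)
    (Φ : CMType F) (hΦ : ι₁ ∈ Φ.1) (i : (I V (repAt a₀) (muLiu ι₁ GramClass.rep))),
    (((uniformOmegaRep (Summit.HodgeConjecture.CorCM.DelRec.exists_recordSystem_of_printed hDel) ⟨HodgeCM.CMField.K F⟩ ι₁ ⟨HodgeCM.HermSpace3.Hm V, HodgeCM.HermSpace3.isHermitian V, HodgeCM.HermSpace3.signature_ι₁ V, HodgeCM.HermSpace3.posDef_of_ne V⟩ Φ e₁ (frameD V) (frameD_real V) (frameD_ne V) (ιVE V) (2 * imagUnit (HodgeCM.CMField.K F))⁻¹ (fun _ _ => (Rep.update ↥(maximalRealSubfield (HodgeCM.CMField.K F)) (imagUnitSq (HodgeCM.CMField.K F)) (Rep.ofLineOf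 ↥(maximalRealSubfield (HodgeCM.CMField.K F)) (imagUnitSq (HodgeCM.CMField.K F))) (locF ↥(maximalRealSubfield (HodgeCM.CMField.K F)) (imagUnitSq (HodgeCM.CMField.K F)) (realUnit ⟨HodgeCM.CMField.K F⟩ (repAt a₀ (Sigma.fst i)).1 (repAt a₀ (Sigma.fst i)).2.1 (repAt a₀ (Sigma.fst i)).2.2)) (realUnit ⟨HodgeCM.CMField.K F⟩ (repAt a₀ (Sigma.fst i)).1 (repAt a₀ (Sigma.fst i)).2.1 (repAt a₀ (Sigma.fst i)).2.2) rfl)))).prop413Data ((liuDictionaryPin exists_isReal_hodgeModel_holds hodgePQ_independent_of_hodgeModel_holds BallQuotient.ballQuotientUniformised_holds (cmAbelianVarietyRealised_of_eigenbasis exists_isReal_hodgeModel_holds hodgePQ_independent_of_hodgeModel_holds cmAbelianVarietyEigenbasisRealised_holds) Literature.NumberTheory.Transcendental.arapura2012_cor_15_4_6_holds V (I V (repAt a₀) (muLiu ι₁ GramClass.rep)) (line V (repAt a₀) (muLiu ι₁ GramClass.rep)))).H).multiplicity_le_one_printed :=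
  HJ3aOfLetters.hJ3a_of_letters hE1 hE1'h (cohFinComponentUnique_antihol_of_hol hE1'h) hE2' hDh
    (antiholCotFormSpectralProjection_of_hol hDh) hEh (cohIsotypicLine_antihol_of_hol hEh)

set_option synthInstance.maxHeartbeats 400000 in
set_option maxHeartbeats 8000000 in
/-- **THE CRUX `HCCMUnconditional.H413` BY NAME FROM FIVE LETTERS AND THE TWO OTHER FLOOR ROWS** (`hdictE` = row III-2 (a)′, `hocc` =
row III-2 (c)′, VERBATIM as in `HJ3aOfLetters.H413_of_letters`). HC_CM is proved only modulo the printed citations until rung 0 closes.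
[cite: Liu2021, Prop. 4.13; Rem. 4.14] [cite: Rogawski1990, Thm. 14.6.4; §15.3] -/
theorem H413_of_five_letters (hE1 : Literature.NumberTheory.Rogawski1990.innerFormMultiplicityLeOne)
    (hE1'h : Literature.NumberTheory.Rogawski1990.cohFinComponentUnique_hol)
    (hE2' : Literature.NumberTheory.Rogawski1990.hodgeTypeRigid)
    (hDh : Literature.NumberTheory.Automorphic.UnitaryGroup.CotangentForms.holCotFormSpectralProjection)
    (hEh : Literature.NumberTheory.Automorphic.UnitaryGroup.CotangentForms.cohIsotypicLine_hol)
    (hdictE :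
      ∀ (hDel : Literature.AlgebraicGeometry.ShimuraVarieties.UnitaryCanonicalModel.canonicalModel_exists_printed)
      (F : HodgeCM.CMField) [IsGalois ℚ F] (h6 : 6 ≤ Module.finrank ℚ F) {ι₁ : F →+* ℂ} (V : HodgeCM.HermSpace3 F ι₁) (a₀ : RealScalar F)
      (Φ : CMType F) (hΦ : ι₁ ∈ Φ.1) (i : (I V (repAt a₀) (muLiu ι₁ GramClass.rep))),
      oscillatorTriple_dictionaryExistence (((uniformOmegaRep (Summit.HodgeConjecture.CorCM.DelRec.exists_recordSystem_of_printed hDel) ⟨HodgeCM.CMField.K F⟩ ι₁ ⟨HodgeCM.HermSpace3.Hm V, HodgeCM.HermSpace3.isHermitian V, HodgeCM.HermSpace3.signature_ι₁ V, HodgeCM.HermSpace3.posDef_of_ne V⟩ Φ e₁ (frameD V) (frameD_real V) (frameD_ne V) (ιVE V) (2 * imagUnit (HodgeCM.CMField.K F))⁻¹ (fun _ _ => (Rep.update ↥(maximalRealSubfield (HodgeCM.CMField.K F)) (imagUnitSq (HodgeCM.CMField.K F)) (Rep.ofLineOf ↥(maximalRealSubfield (HodgeCM.CMField.K F)) (imagUnitSq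 (HodgeCM.CMField.K F))) (locF ↥(maximalRealSubfield (HodgeCM.CMField.K F)) (imagUnitSq (HodgeCM.CMField.K F)) (realUnit ⟨HodgeCM.CMField.K F⟩ (repAt a₀ (Sigma.fst i)).1 (repAt a₀ (Sigma.fst i)).2.1 (repAt a₀ (Sigma.fst i)).2.2)) (realUnit ⟨HodgeCM.CMField.K F⟩ (repAt a₀ (Sigma.fst i)).1 (repAt a₀ (Sigma.fst i)).2.1 (repAt a₀ (Sigma.fst i)).2.2) rfl)))).prop413Data ((liuDictionaryPin exists_isReal_hodgeModel_holds hodgePQ_independent_of_hodgeModel_holds BallQuotient.ballQuotientUniformised_holds (cmAbelianVarietyRealised_of_eigenbasis exists_isReal_hodgeModel_holds hodgePQ_independent_of_hodgeModel_holds cmAbelianVarietyEigenbasisRealised_holds) Literature.NumberTheory.Transcendental.arapura2012_cor_15_4_6_holds V (I V (repAt a₀) (muLiu ι₁ GramClass.rep)) (line V (repAt a₀) (muLiu ι₁ GramClass.rep)))).H))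
    (hocc :
      ∀ (hDel : Literature.AlgebraicGeometry.ShimuraVarieties.UnitaryCanonicalModel.canonicalModel_exists_printed)
      (F : HodgeCM.CMField) [IsGalois ℚ F] (h6 : 6 ≤ Module.finrank ℚ F) {ι₁ : F →+* ℂ} (V : HodgeCM.HermSpace3 F ι₁) (a₀ : RealScalar F)
      (Φ : CMType F) (hΦ : ι₁ ∈ Φ.1) (i : (I V (repAt a₀) (muLiu ι₁ GramClass.rep))),
      admissible_occursInH1 (((uniformOmegaRep (Summit.HodgeConjecture.CorCM.DelRec.exists_recordSystem_of_printed hDel) ⟨HodgeCM.CMField.K F⟩ ι₁ ⟨HodgeCM.HermSpace3.Hm V, HodgeCM.HermSpace3.isHermitian V, HodgeCM.HermSpace3.signature_ι₁ V, HodgeCM.HermSpace3.posDef_of_ne V⟩ Φ e₁ (frameD V) (frameD_real V) (frameD_ne V) (ιVE V) (2 * imagUnit (HodgeCM.CMField.K F))⁻¹ (fun _ _ => (Rep.update ↥(maximalRealSubfield (HodgeCM.CMField.K F)) (imagUnitSq (HodgeCM.CMField.K F)) (Rep.ofLineOf ↥(maximalRealSubfield (HodgeCM.CMField.K F)) (imagUnitSq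 (HodgeCM.CMField.K F))) (locF ↥(maximalRealSubfield (HodgeCM.CMField.K F)) (imagUnitSq (HodgeCM.CMField.K F)) (realUnit ⟨HodgeCM.CMField.K F⟩ (repAt a₀ (Sigma.fst i)).1 (repAt a₀ (Sigma.fst i)).2.1 (repAt a₀ (Sigma.fst i)).2.2)) (realUnit ⟨HodgeCM.CMField.K F⟩ (repAt a₀ (Sigma.fst i)).1 (repAt a₀ (Sigma.fst i)).2.1 (repAt a₀ (Sigma.fst i)).2.2) rfl)))).prop413Data ((liuDictionaryPin exists_isReal_hodgeModel_holds hodgePQ_independent_of_hodgeModel_holds BallQuotient.ballQuotientUniformised_holds (cmAbelianVarietyRealised_of_eigenbasis exists_isReal_hodgeModel_holds hodgePQ_independent_of_hodgeModel_holds cmAbelianVarietyEigenbasisRealised_holds) Literature.NumberTheory.Transcendental.arapura2012_cor_15_4_6_holds V (I V (repAt a₀) (muLiu ι₁ GramClass.rep)) (line V (repAt a₀) (muLiu ι₁ GramClass.rep)))).H)) :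
    Summit.HodgeConjecture.HodgeConjecture.Theses.HCCMUnconditional.H413 :=
  HJ3aOfLetters.H413_of_letters hE1 hE1'h (cohFinComponentUnique_antihol_of_hol hE1'h) hE2' hDh
    (antiholCotFormSpectralProjection_of_hol hDh) hEh (cohIsotypicLine_antihol_of_hol hEh) hdictE hocc

end Summit.HodgeConjecture.HodgeConjecture.Cruxes.H413.HJ3aOfFiveLetters

end
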